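import Summits.QuantumFields.YangMills.Theorems.LangevinControlUVFemtoCurvatureTwoPointCDoublingCover
import Summits.QuantumFields.YangMills.Theorems.LangevinControlUVFemtoCurvatureTwoPointCStubSliceLoc
import Summits.QuantumFields.YangMills.Theorems.LangevinControlUVFemtoCurvatureTwoPointCStubSliceOpen
import HarnessLib

/-!
# Crux `FemtoCurvatureTwoPointC` (stmt-QuantumFields-16204), line `Sketch`, v7 — `stub_sublevelDoubling` (the lead's stub, closed)

**Doubling of the sublevel volumes of Wilson's action on every fixed torus** (`Haar^E{S ≤ t} ≤ K · Haar^E{S ≤ t/4}`, `0 < t ≤ t₀`),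
for every compact `G` and faithful unitary lattice representation `r`: the registered stub of skeleton v7, proved by instantiating the
COVER (`Doubling.sublevelDoubling_of`, `…CDoublingCover`) with the landed local estimates `stub_sliceLoc` (co-Lipschitz scaling on the
gauge tube) and `stub_sliceOpen` (the tube covers a neighbourhood), the Haar scaling being the stub's own third hypothesis
(`stub_haarCoLipschitz`). With `stub_secondMomentOfDoubling` and `stub_smallTorusOfSecondMoment` this takes the small-torus variance law
(`SmallTorusVarianceLaw`) OFF the named fact `WilsonPartitionRegularVariation` — no resolution of singularities is used anywhere: the
flat set is conical in exponential gauge slices (Koszul `H¹` = zero modes; commutators vs brackets; cone; slice; cover).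
Everything here is proved; no definitions.
-/

set_option autoImplicit false

noncomputable section

open scoped Matrix Matrix.Norms.Frobenius InnerProductSpace ENNReal NNReal
open MeasureTheory
open Literature.MathematicalPhysics.QuantumLattice Literature.MathematicalPhysics.QuantumFieldTheory

namespace Summit.QuantumFields.YangMills.Theorems.FemtoCurvatureTwoPointC

/-- **`stub_sublevelDoubling` (registered stub of line `Sketch`, skeleton v7).** For every compact `G`, lattice representation `r` and
torus `(ℤ/L)⁴`: `Haar^E{S ≤ t} ≤ K · Haar^E{S ≤ t/4}` for `0 < t ≤ t₀` (the three hypotheses are the ingredient stubs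
`stub_expCommutatorBracket`, `stub_koszulH1`, `stub_haarCoLipschitz` verbatim; the first two are consumed inside the landed cone/Koszul
files, the third is passed to the cover). -/
theorem stub_sublevelDoubling :
    (∀ (N : ℕ) (a b : Matrix (Fin N) (Fin N) ℂ), aᴴ = -a → bᴴ = -b →
      ‖NormedSpace.exp a * NormedSpace.exp b * NormedSpace.exp (-a) * NormedSpace.exp (-b) - 1‖ ≤ ‖a * b - b * a‖ ∧
      (‖a‖ ≤ 1 / 4 → ‖b‖ ≤ 1 / 4 →
        1 / 4 * ‖a * b - b * a‖ ≤
          ‖NormedSpace.exp a * NormedSpace.exp b * NormedSpace.exp (-a) * NormedSpace.exp (-b) - 1‖)) →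
    (∀ (W : Type) [NormedAddCommGroup W] [InnerProductSpace ℝ W] [FiniteDimensional ℝ W] (k : ℕ)
      (S : Fin k → W →ₗ[ℝ] W), (∀ i w, ‖S i w‖ = ‖w‖) → (∀ i j w, S i (S j w) = S j (S i w)) →
      ∀ X : Fin k → W, (∀ i j, S i (X j) - X j = S j (X i) - X i) →
        ∃ (m : W) (c : Fin k → W), (∀ i j, S i (c j) = c j) ∧ ∀ i, X i = (S i m - m) + c i) →
    (∀ (G : Type) [Group G] [TopologicalSpace G] [IsTopologicalGroup G] [CompactSpace G] [MeasurableSpace G] [BorelSpace G]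
      (N : ℕ) (ρ : G →* Matrix (Fin N) (Fin N) ℂ), Continuous ρ → Function.Injective ρ →
      (∀ g, ρ g ∈ Matrix.unitaryGroup (Fin N) ℂ) →
      ∀ (ι : Type) [Fintype ι], ∃ (D : ℝ) (C : ℝ≥0), 0 ≤ D ∧
        ∀ (K : ℝ≥0) (X Y : Set (ι → G)), MeasurableSet X → MeasurableSet Y →
          ∀ F : (ι → G) → (ι → G), Set.MapsTo F X Y →
            (∀ u ∈ X, ∀ v ∈ X, ‖(fun e => ρ (u e) - ρ (v e))‖ ≤ K * ‖(fun e => ρ (F u e) - ρ (F v e))‖) →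
            Measure.pi (fun _ : ι => haarProbability G) X ≤
              (C : ℝ≥0∞) * (K : ℝ≥0∞) ^ D * Measure.pi (fun _ : ι => haarProbability G) Y) →
    ∀ (G : Type) [Group G] [TopologicalSpace G] [IsTopologicalGroup G] [CompactSpace G] [MeasurableSpace G] [BorelSpace G]
      (r : LatticeRep G) (L : ℕ) [NeZero L],
      ∃ (K : ℝ≥0) (t₀ : ℝ), 0 < t₀ ∧ ∀ t : ℝ, 0 < t → t ≤ t₀ →
        Measure.pi (fun _ : Edge 4 L => haarProbability G) {U : GaugeConfig 4 L G | wilsonAction r.ρ U ≤ t} ≤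
          K * Measure.pi (fun _ : Edge 4 L => haarProbability G) {U : GaugeConfig 4 L G | wilsonAction r.ρ U ≤ t / 4} :=
  fun _ _ hhaar => Doubling.sublevelDoubling_of stub_sliceLoc stub_sliceOpen hhaar

end Summit.QuantumFields.YangMills.Theorems.FemtoCurvatureTwoPointC

end
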